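import Mathlib
import Summits.ValiantsHypothesis.ValiantsHypothesis.Theorems.GrenetZeonTwoDimCoefficientsEquivalence
import Summits.ValiantsHypothesis.ValiantsHypothesis.Theorems.GrenetZeonHessianRankCodimTwo

/-!
# Crux `GrenetZeon.TwoDimCoefficients` (stmt-ValiantsHypothesis-8062) after `HessianRankCodimTwo` (stmt-8061):
# the conditional forms of the line `dim2_cases` become unconditional

The dependency crux `HessianRankCodimTwo` (stmt-ValiantsHypothesis-8061) is PROVED (closed 2026-08-28 by
`Theorems.GrenetZeonHessianRankCodimTwo.hessianRankCodimTwo_proof`, p595122: bordered Latin planes,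
val-width-8061-p1 g2 LEAD / -p3 g2 / val-width-8062-p4, `…GrenetZeonHessianRankCodimTwoBorder*.lean`).
Consequently every statement of the line `dim2_cases` that was "conditional on 8061 alone" holds outright:

* `hasDim2Repr_sq_le_or_unipotent_all` — the crux in DISJUNCTIVE form, unconditionally: every
  `(m, ≤ 2)`-representation of `per_n` (`n ≥ n₀`) has `n² ≤ C·m` or is a unipotent dual representation;
* `twoDimCoefficients_of_dualUnipotentBound_all : DualUnipotentBound → TwoDimCoefficients` and
  `twoDimCoefficients_iff_dualUnipotentBound_all : TwoDimCoefficients ↔ DualUnipotentBound` —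
  the crux AS TYPED is now EQUIVALENT to its one open stub `stub_dualUnipotent` (open-problem grade,
  `CALIBRATION-stub_dualUnipotent.md`); the skeleton's composition `TwoDimCoefficients_of` needs no
  hypothesis any more.

HONEST FRAMING: constant-factor statements inside the Mignon–Ressayre regime; the open content of 8062 is
exactly `DualUnipotentBound`; VP ≠ VNP is not moved by anything here.
-/

-- single-conjunct layout `Summits/ValiantsHypothesis/ValiantsHypothesis`: the duplicated namespace
-- component is mandated by the tree.
set_option linter.dupNamespace false

noncomputable section

namespace Summit.ValiantsHypothesis.ValiantsHypothesis.Cruxes.TwoDimCoefficients.DimTwoCases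

open Literature.Computability.AlgebraicComplexity
open Summit.ValiantsHypothesis.ValiantsHypothesis.Theses.GrenetZeon
open Summit.ValiantsHypothesis.ValiantsHypothesis.Theorems.GrenetZeonHessianRankCodimTwo

/-- **The crux in disjunctive form, unconditionally.** [folklore] -/
theorem hasDim2Repr_sq_le_or_unipotent_all :
    ∃ C n₀ : ℕ, ∀ n ≥ n₀, ∀ m : ℕ, HasDim2Repr n m → n ^ 2 ≤ C * m ∨ DualUnipotentRepr n m :=
  hasDim2Repr_sq_le_or_unipotent_of_hessianRankCodimTwo hessianRankCodimTwo_proof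

/-- **The crux from its one open stub, unconditionally:** `DualUnipotentBound → TwoDimCoefficients`.
[folklore] -/
theorem twoDimCoefficients_of_dualUnipotentBound_all (hD : DualUnipotentBound) : TwoDimCoefficients :=
  twoDimCoefficients_of_dualUnipotentBound hessianRankCodimTwo_proof hD

/-- **The crux IS its one open stub:** `TwoDimCoefficients ↔ DualUnipotentBound`, unconditionally.
[folklore] -/
theorem twoDimCoefficients_iff_dualUnipotentBound_all : TwoDimCoefficients ↔ DualUnipotentBound :=
  twoDimCoefficients_iff_dualUnipotentBound hessianRankCodimTwo_proof

end Summit.ValiantsHypothesis.ValiantsHypothesis.Cruxes.TwoDimCoefficients.DimTwoCases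

end
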